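import Summits.QuantumAdvantage.QuantumAdvantage.Theorems.CubicForrelationNearExactIsExactSixThetaExact
import Summits.QuantumAdvantage.QuantumAdvantage.Theorems.CubicForrelationNearExactIsExactValueGranularity
import Summits.QuantumAdvantage.QuantumAdvantage.Theorems.CubicForrelationNearExactIsExactWalshTower
import Summits.QuantumAdvantage.QuantumAdvantage.Theorems.CubicForrelationNearExactIsExactTenCharacter

/-!
# Crux `CubicForrelation.NearExactIsExact` (stmt-QuantumAdvantage-14043) — `n = 6`: two-sided value granularity and
  the THREE largest forrelation values `1 > 25/32 > 3/4` (part 5, add-on to parts 1–4)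

Certificate seat `b2b-cforr-cert` (gen 10).  HONEST FRAMING: a decidable verdict about the finite slice `n = 6` — NOT summit
progress.

TWO-SIDED GRANULARITY (`sv_granularity_six`, standard axioms): for cubic `f, g : 𝔽₂⁶ → 𝔽₂`, `32·Φ(f,g) ∈ ℤ`.  (The
one-sided `stub_valueGranularity` — `g` cubic, `f` arbitrary — gives only `128·Φ ∈ ℤ` at `n = 6`.)  Proof: `2⁹Φ =
Σ_x (−1)^{f(x)} W_g(x)` with `W_g = 4u` (McEliece), the parity of `u` is CONSTANT (Walsh tower, degree `0` at `n = 6`),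
`Σ_x u(x) = 16·(−1)^{g(0)}` (Walsh inversion) and `#{f = 1}` is even (McEliece for `f`), so
`Σ_x (−1)^{f(x)} u(x) = Σ u − 2 Σ_{f=1} u ≡ 0 (mod 4)`.

CONSEQUENCE (`forrelation_values_six_top`, with part 4's `nearExact_top_six`, hence `native_decide`-dependent): every
cubic pair on `6` bits has `Φ = 1`, `Φ = 25/32`, or `Φ ≤ 3/4`; all three values occur (`forrelation_f6W_g6W = 25/32`,
`forrelation_f6B_g6B = 3/4` for the bent pair `g = x₀x₁ ⊕ x₂x₃ ⊕ x₄x₅`, `f = g ⊕ x₀x₁x₂`), so the three largest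
forrelation values of cubic pairs on `6` bits are exactly `1 > 25/32 > 3/4` (`forrelation_values_six_third`).

References: R. J. McEliece, *Weight congruences for p-ary cyclic codes*, Discrete Math. 3 (1972); C. Carlet, *Boolean
Functions for Cryptography and Coding Theory* (CUP 2021) §4.1; S. Aaronson, A. Ambainis, *Forrelation*, SIAM J. Comput.
47 (2018) §1.1.1.  Everything below is proved from the tree.
-/

set_option linter.dupNamespace false -- D-0017: single-problem summit ⇒ `QuantumAdvantage.QuantumAdvantage` by design

namespace Summit.QuantumAdvantage.QuantumAdvantage.Theorems.CubicForrelation.NearExactIsExact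

open Finset
open Literature.Computability.QuantumComplexity
open Literature.Computability.QuantumComplexity.DerivativeWalsh (W)
open Literature.Computability.QuantumComplexity.Simon (sum_twist)
open Summit.QuantumAdvantage.QuantumAdvantage.Theorems.SignedExactSliceIsLift.StubMoebius (isDegLeFun_xor isDegLeFun_and)
open Summit.QuantumAdvantage.QuantumAdvantage.Theorems.NearExactIsExact.Negative.SmallCases
  (pt sgnZ wal wspec sigTable wal_sigTable)

/-! ### Walsh inversion at the origin and two-sided granularity -/

/-- **Walsh inversion at the origin**: `Σ_x W_g(x) = 2ⁿ (−1)^{g(0)}`. [folklore] -/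
theorem sv_sum_W {n : ℕ} (g : (Fin n → Bool) → Bool) :
    ∑ x, W (fun y => signOf (g y)) x = (2 : ℝ) ^ n * signOf (g fun _ => false) := by
  unfold W
  rw [sum_comm]
  simp_rw [← mul_sum, sum_twist]
  rw [Finset.sum_eq_single (fun _ => false)]
  · simp [mul_comm]
  · intro y _ hy; rw [if_neg hy, mul_zero]
  · intro h; exact absurd (mem_univ _) h

/-- **Two-sided granularity on `6` bits**: for cubic `f, g : 𝔽₂⁶ → 𝔽₂`, `Φ(f,g) ∈ (1/32)ℤ`. [this work] -/
theorem sv_granularity_six (f g : (Fin (3 + 3) → Bool) → Bool) (hf : IsDegLeFun 3 f) (hg : IsDegLeFun 3 g) :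
    ∃ z : ℤ, forrelation f g = (z : ℝ) / 32 := by
  -- `W_g = 4u`
  choose u hu using fun x => vg_W_granular stub_axParity g hg x
  have hu' : ∀ x, W (fun y => signOf (g y)) x = (2 : ℝ) ^ 2 * (u x : ℝ) := fun x => by
    rw [hu x]
  -- the parity of `u` is constant
  have hdeg := stub_walshTower stub_axParity (3 + 3) 2 0 g u hg hu' (by intro k hk hkn; omega)
  have hpar : ∀ x, decide (Odd (u x)) = decide (Odd (u fun _ => false)) := fun x => tc_const_of_deg_zero hdeg x _
  -- `Σ u = 16·(−1)^{g(0)}`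
  have hsumu : ∑ x, (u x : ℝ) = 16 * signOf (g fun _ => false) := by
    have h := sv_sum_W g
    simp_rw [hu'] at h
    rw [← mul_sum] at h
    have h4 : (2 : ℝ) ^ 2 = 4 := by norm_num
    have h64 : (2 : ℝ) ^ (3 + 3) = 64 := by norm_num
    rw [h4, h64] at h
    linarith
  -- `#{f = 1}` is even
  obtain ⟨zf, hzf⟩ := stub_axParity (3 + 3) 3 f univ (by norm_num) hf
  have huniv : (univ.filter fun v : Fin (3 + 3) → Bool => ∀ i, v i = true → i ∈ (univ : Finset (Fin (3 + 3)))) =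
      univ := by
    ext v; simp
  rw [huniv, card_univ, Fintype.card_fin] at hzf
  have h4' : (2 : ℝ) ^ ((3 + 3 + 3 - 1) / 3) = 4 := by norm_num
  rw [h4'] at hzf
  have hcard := sy_sum_signOf_add_card f
  have h64' : (2 : ℝ) ^ (3 + 3) = 64 := by norm_num
  rw [h64'] at hcard
  set A := univ.filter (fun x : Fin (3 + 3) → Bool => f x = true) with hA
  have hAZ : (A.card : ℤ) = 32 - 2 * zf := by
    have h1 : (2 : ℝ) * (A.card : ℝ) = 64 - 4 * (zf : ℝ) := by linarith
    have h2 : (((2 * (A.card : ℤ)) : ℤ) : ℝ) = (((64 - 4 * zf) : ℤ) : ℝ) := by push_cast; linarith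
    have h3 := (Int.cast_inj (α := ℝ)).1 h2
    linarith
  -- `Σ_{f = 1} u` is even
  have hSA : ∃ t : ℤ, ∑ x ∈ A, u x = 2 * t := by
    by_cases hodd : Odd (u fun _ => false)
    · have hall : ∀ x, Odd (u x) := fun x => by
        have h := hpar x
        rw [decide_eq_true hodd] at h
        exact of_decide_eq_true h
      choose k hk using hall
      refine ⟨∑ x ∈ A, k x + (16 - zf), ?_⟩
      rw [sum_congr rfl fun x _ => hk x, sum_add_distrib, sum_const, nsmul_eq_mul, mul_one, ← mul_sum, hAZ]
      ring
    · have hall : ∀ x, Even (u x) := fun x => by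
        have h := hpar x
        rw [decide_eq_false hodd] at h
        exact Int.not_odd_iff_even.1 (of_decide_eq_false h)
      obtain ⟨t, ht⟩ := Finset.even_sum (s := A) (f := u) fun x _ => hall x
      exact ⟨t, by rw [ht]; ring⟩
  obtain ⟨t, ht⟩ := hSA
  have htR : ∑ x ∈ A, (u x : ℝ) = 2 * (t : ℝ) := by exact_mod_cast ht
  -- `2⁹ Φ = 4 Σ (−1)^f u = 4 (Σ u − 2 Σ_{f=1} u)`
  have hval : (2 : ℝ) ^ (3 * 3) * forrelation f g = 4 * ∑ x, signOf (f x) * (u x : ℝ) := by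
    rw [vg_two_pow_mul_forrelation, mul_sum]
    refine sum_congr rfl fun x _ => ?_
    rw [hu' x]; ring
  have hsplit : ∑ x, signOf (f x) * (u x : ℝ) = ∑ x, (u x : ℝ) - 2 * ∑ x ∈ A, (u x : ℝ) := by
    rw [hA, sum_filter, mul_sum, ← sum_sub_distrib]
    refine sum_congr rfl fun x _ => ?_
    cases f x
    · simp [signOf]
    · simp [signOf]; ring
  rw [hsplit, hsumu, htR] at hval
  rcases Bool.eq_false_or_eq_true (g fun _ => false) with h0 | h0
  · refine ⟨-4 - t, ?_⟩
    rw [h0] at hval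
    simp only [signOf, if_true] at hval
    push_cast
    norm_num at hval ⊢
    linarith
  · refine ⟨4 - t, ?_⟩
    rw [h0] at hval
    simp only [signOf, Bool.false_eq_true, if_false] at hval
    push_cast
    norm_num at hval ⊢
    linarith

/-! ### The three largest values -/

/-- **Top of the value set on `6` bits.** Every cubic pair on `6` bits has `Φ = 1`, `Φ = 25/32`, or `Φ ≤ 3/4`. [this work] -/
theorem forrelation_values_six_top : ∀ f g : (Fin 6 → Bool) → Bool, IsDegLeFun 3 f → IsDegLeFun 3 g →
    forrelation f g = 1 ∨ forrelation f g = 25 / 32 ∨ forrelation f g ≤ 3 / 4 := by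
  intro f g hf hg
  rcases nearExact_top_six f g hf hg with h | h
  · exact Or.inl h
  · obtain ⟨z, hz⟩ := sv_granularity_six f g hf hg
    rw [hz] at h ⊢
    have hz25 : z ≤ 25 := by
      have : (z : ℝ) ≤ 25 := by linarith
      exact_mod_cast this
    rcases hz25.lt_or_eq with hlt | heq
    · right; right
      have : (z : ℝ) ≤ 24 := by exact_mod_cast (show z ≤ 24 by omega)
      linarith
    · right; left; rw [heq]; norm_num

/-- `g6B = x₀x₁ ⊕ x₂x₃ ⊕ x₄x₅`: the inner-product bent function on `6` bits. -/
def g6B (x : Fin 6 → Bool) : Bool := xor (xor (x 0 && x 1) (x 2 && x 3)) (x 4 && x 5)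

/-- `f6B = g6B ⊕ x₀x₁x₂`: the (self-)dual of `g6B` perturbed by a cubic monomial of weight `8`. -/
def f6B (x : Fin 6 → Bool) : Bool := xor (xor (xor (x 0 && x 1) (x 2 && x 3)) (x 4 && x 5)) (x 0 && x 1 && x 2)

/-- `g6B` is cubic. [cite: Carlet2020, §2.2.1 Def. 6] -/
theorem isDegLeFun_g6B : IsDegLeFun 3 g6B := by
  unfold g6B
  exact isDegLeFun_xor (isDegLeFun_xor (isDegLeFun_and2 0 1) (isDegLeFun_and2 2 3)) (isDegLeFun_and2 4 5)

/-- `f6B` is cubic. [cite: Carlet2020, §2.2.1 Def. 6] -/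
theorem isDegLeFun_f6B : IsDegLeFun 3 f6B := by
  unfold f6B
  exact isDegLeFun_xor (isDegLeFun_xor (isDegLeFun_xor (isDegLeFun_and2 0 1) (isDegLeFun_and2 2 3))
    (isDegLeFun_and2 4 5)) (isDegLeFun_and3 0 1 2)

/-- The kernel evaluation: `Σ_k (−1)^{f6B(pt k)} · (wal (sigTable g6B))_k = 384`. [folklore] -/
theorem val_f6B_g6B :
    ((List.range 64).map fun k => sgnZ (f6B (pt 6 k)) * ((wal 6 (sigTable 6 g6B))[k]?.getD 0)).sum = 384 := by
  decide

/-- **The third value is attained**: `Φ(f6B, g6B) = 3/4`. [this work] -/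
theorem forrelation_f6B_g6B : forrelation f6B g6B = 3 / 4 := by
  have h := ck_forrelation_mul_eq 3 f6B g6B
  have hsum : ∑ k ∈ range (2 ^ (3 + 3)), sgnZ (f6B (pt (3 + 3) k)) * wspec (3 + 3) g6B k = 384 := by
    rw [← val_f6B_g6B, ck_sum_map_range]
    refine sum_congr rfl fun k hk => ?_
    rw [wal_sigTable 6 g6B k (mem_range.1 hk)]
  rw [hsum] at h
  norm_num at h
  linarith

/-- **The three largest forrelation values of cubic pairs on `6` bits are `1 > 25/32 > 3/4`**: below `25/32` the
largest value is `3/4` (`IsGreatest`). [this work] -/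
theorem forrelation_values_six_third :
    IsGreatest {φ : ℝ | ∃ f g : (Fin 6 → Bool) → Bool, IsDegLeFun 3 f ∧ IsDegLeFun 3 g ∧
      forrelation f g = φ ∧ φ < 25 / 32} (3 / 4) := by
  refine ⟨⟨f6B, g6B, isDegLeFun_f6B, isDegLeFun_g6B, forrelation_f6B_g6B, by norm_num⟩, ?_⟩
  rintro φ ⟨f, g, hf, hg, rfl, hlt⟩
  rcases forrelation_values_six_top f g hf hg with h | h | h
  · rw [h] at hlt; norm_num at hlt
  · rw [h] at hlt; norm_num at hlt
  · exact h

end Summit.QuantumAdvantage.QuantumAdvantage.Theorems.CubicForrelation.NearExactIsExact
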